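import Mathlib
import Summits.Ventures.PercRepro2.SwOutShadowMultiRootClosure
import Summits.Ventures.PercRepro2.SwOutShadowMultiRootEBase

/-!
# The canonical decorated base of a side point (blind cell PercRepro2, night-4 g35, 2026-08-29;
proofs/NIGHT4-G35.md §4)

At a side point `ζ` of a fibre of the escaping set — the roots `R ∋ h` non-escaping, every other
vertex of the region exempt, in `X`, with an outside edge, isolated, or ESCAPING — the canonical
units of SwOutShadowMultiRootKinds are a decorated multi-root base once they are PURE (every edge at
a decoration vertex goes to its own unit's arms, its own decoration, or `l`), pairwise DISJOINT,
and ATTACHED (every decoration vertex blue-connected to `l` by blue edges touching its unit, at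
the base): **`decoBaseE_baseDeco`** — the hull part is g34's `MultiBaseE` of the arms, merged into
the units (the arm part of a unit is a union of arms of one colour) and transported from `baseRR`
to `baseDeco` (the two agree on every edge touching the hull) —, and the side point is the cube
point `omegaDeco` of its base: **`decoRealRR_baseDeco_omegaDeco`**.  Census
(mining/night-4/g35/shadow12.py): purity, disjointness and attachment hold at every side point of
3,562 of the 4,868 open pairs at `n = 7` and at all 33 at `n = 6`.
-/

namespace Summit.Ventures.PercRepro2

namespace LocRows

open Hull

variable {V : Type*} {E : Type*}

open scoped Classical

variable {ends : E → Sym2 V}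

section Units

variable [Fintype E] [DecidableEq E] {U : Set V} {ξ : Config E} {l h : V} {R : Set V}
  {𝓤 𝓓 𝓓'' : Set (Set V)} {X : Set V} {𝓤' : Set (Set V)} {F : V → Prop} {ζ : Config E}
  (hl : l ∉ U) (hloop : ∀ e r, r ∈ R → ends e ≠ s(r, r))
  (hF : ∀ x, F x → ∀ S ∈ 𝓤, x ∈ S)
  (hout : ∀ x ∈ U, x ∉ R →
    F x ∨ x ∈ X ∨ (∃ e y, ends e = s(x, y) ∧ y ∉ U) ∨ (∀ e, x ∉ ends e) ∨ ¬ hull ends ζ x ⊆ U)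
  (hX : ∀ x ∈ X, x ∈ U → ∀ e, x ∈ ends e → ends e = s(x, x))
  (hζ : ζ ∈ gOutSide ends l h 𝓤 𝓓 𝓓'' X 𝓤' U ξ)
  (hne : ∀ r ∈ R, hull ends ζ r ⊆ U)
include hl hF hout hX hζ hne

/-- A hull vertex of a unit has that unit. -/
lemma unitOf_eq_of_mem {y x : V} (hyH : y ∈ extHullR ends R ζ) (hyR : y ∉ R)
    (hx : x ∈ unitOf ends R l ζ y) (hxH : x ∈ extHullR ends R ζ) :
    unitOf ends R l ζ x = unitOf ends R l ζ y := by
  rcases mem_redPartR_or_bluePartR hyH hyR with hy | hy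
  · have hx' := unit_red_closed hl hF hout hX hζ hne hy x hx hxH
    simp only [unitOf, if_pos hy] at hx
    simp only [unitOf, if_pos hy, if_pos hx']
    exact cluster_eq_of_mem' hx
  · have hyR' : y ∉ redPartR ends R ζ := fun h' =>
      Esc.redPartR_disjoint_bluePartR hl hF hout hX hζ hne h' hy
    have hx' := unit_blue_closed hl hF hout hX hζ hne hy x hx hxH
    have hxR' : x ∉ redPartR ends R ζ := fun h' =>
      Esc.redPartR_disjoint_bluePartR hl hF hout hX hζ hne h' hx'
    simp only [unitOf, if_neg hyR'] at hx
    simp only [unitOf, if_neg hyR', if_neg hxR']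
    exact cluster_eq_of_mem' hx

/-- The unit of every non-root vertex of the hull is one of the units. -/
lemma unitOf_mem_unitsR_of_mem {x : V} (hxH : x ∈ extHullR ends R ζ) (hxR : x ∉ R) :
    unitOf ends R l ζ x ∈ unitsR ends R l ζ := by
  have harm := armR_mem_armsR_of_mem_extHullR hxH hxR
  obtain ⟨e, he, harm'⟩ := Finset.mem_image.1 harm
  simp only [rootEdgesR, Finset.mem_filter, Finset.mem_univ, true_and] at he
  obtain ⟨r, hr, y, hry, hyR⟩ := he
  rw [armOfEdgeR_eq hr hry hyR] at harm'
  -- `armR y = armR x`: `y` lies in the arm of `x`, hence in its unit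
  have hy : y ∈ unitOf ends R l ζ x := armR_subset_unitOf x (by rw [← harm']; exact mem_armR_self y)
  have hyH : y ∈ extHullR ends R ζ := ⟨r, hr, mem_hull_of_adj_root hry⟩
  have key : unitOf ends R l ζ y ∈ unitsR ends R l ζ := unitOf_mem_unitsR hr hry hyR
  rwa [unitOf_eq_of_mem hl hF hout hX hζ hne hxH hxR hy hyH] at key

/-- Every unit of a non-root hull vertex has its arm part in the red part or in the blue part. -/
lemma unitArm_unitOf_subset_part {y : V} (hyH : y ∈ extHullR ends R ζ) (hyR : y ∉ R) :
    unitArm ends R ζ (unitOf ends R l ζ y) ⊆ redPartR ends R ζ ∨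
      unitArm ends R ζ (unitOf ends R l ζ y) ⊆ bluePartR ends R ζ := by
  rcases mem_redPartR_or_bluePartR hyH hyR with hy | hy
  · exact Or.inl fun x hx => unit_red_closed hl hF hout hX hζ hne hy x hx.1 hx.2
  · exact Or.inr fun x hx => unit_blue_closed hl hF hout hX hζ hne hy x hx.1 hx.2

omit hl hF hout hX hζ hne in
/-- Every unit of the family is the unit of a non-root hull vertex. -/
lemma exists_of_mem_unitsR' {u : Set V} (hu : u ∈ unitsR ends R l ζ) :
    ∃ y, y ∈ extHullR ends R ζ ∧ y ∉ R ∧ u = unitOf ends R l ζ y := by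
  obtain ⟨y, ⟨e, r, hr, hry⟩, hyR, rfl⟩ := exists_of_mem_unitsR hu
  exact ⟨y, ⟨r, hr, mem_hull_of_adj_root hry⟩, hyR, rfl⟩

/-- **The blue units are the units assigned `false` by `omegaDeco`.** -/
theorem blueUnits_eq :
    blueUnits ends R l ζ =
      armsFalseC (unitAZ (fun u : ↥(unitsR ends R l ζ) => unitArm ends R ζ u.1)
        (fun u => unitDeco ends R ζ u.1)) (armPart (omegaDeco ends R l ζ)) := by
  ext x
  constructor
  · rintro ⟨y, hy, hx⟩
    have hyH : y ∈ extHullR ends R ζ := bluePartR_subset hy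
    refine ⟨⟨unitOf ends R l ζ y, unitOf_mem_unitsR_of_mem hl hF hout hX hζ hne hyH hy.2⟩, ?_, ?_⟩
    · simp only [armPart, omegaDeco, Sum.elim_inl, decide_eq_false_iff_not, not_not]
      exact fun x hx => unit_blue_closed hl hF hout hX hζ hne hy x hx.1 hx.2
    · show x ∈ unitArm ends R ζ (unitOf ends R l ζ y) ∪ unitDeco ends R ζ (unitOf ends R l ζ y)
      rw [unitArm_union_unitDeco]; exact hx
  · rintro ⟨u, hu, hx⟩
    simp only [armPart, omegaDeco, Sum.elim_inl, decide_eq_false_iff_not, not_not] at hu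
    obtain ⟨y, hyH, hyR, hy⟩ := exists_of_mem_unitsR' u.2
    change x ∈ unitArm ends R ζ u.1 ∪ unitDeco ends R ζ u.1 at hx
    rw [unitArm_union_unitDeco] at hx
    have hyB : y ∈ bluePartR ends R ζ := hu ⟨by rw [hy]; exact mem_unitOf_self y, hyH⟩
    exact ⟨y, hyB, by rw [← hy]; exact hx⟩

/-- Purity: every edge at a decoration vertex of a unit goes to the unit's arm part, stays in its
decoration, or goes to `l`. -/
def Pure (ends : E → Sym2 V) (R : Set V) (l : V) (ζ : Config E) : Prop :=
  ∀ u ∈ unitsR ends R l ζ, ∀ e z y, ends e = s(z, y) → z ∈ unitDeco ends R ζ u →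
    y ∈ unitArm ends R ζ u ∨ y ∈ unitDeco ends R ζ u ∨ y = l

/-- **The decorated base agrees with g34's base on every edge touching the hull** (purity). -/
theorem baseDeco_eq_baseRR_of_touches (hP : Pure ends R l ζ) {e : E}
    (he : e ∈ touches ends (extHullR ends R ζ)) :
    baseDeco ends R l ζ e = baseRR ends R ζ e := by
  by_cases hrr : e ∈ rrEdges ends R
  · rw [baseDeco_apply_of_mem hrr, baseRR_apply_of_mem hrr]
  rw [baseDeco_apply_of_notMem hrr, baseRR_apply_of_notMem hrr]
  unfold baseR
  have key : e ∈ touches ends (blueUnits ends R l ζ) ↔ e ∈ touches ends (bluePartR ends R ζ) := by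
    constructor
    · rintro ⟨x', ⟨y, hy, hx'⟩, w, hxw⟩
      by_cases hx'H : x' ∈ extHullR ends R ζ
      · exact ⟨x', unit_blue_closed hl hF hout hX hζ hne hy x' hx' hx'H, w, hxw⟩
      · -- `x'` is a decoration vertex of the blue unit of `y`: its edge goes to the arm part
        have hyH : y ∈ extHullR ends R ζ := bluePartR_subset hy
        have hu := unitOf_mem_unitsR_of_mem hl hF hout hX hζ hne hyH hy.2
        -- the end of `e` in the hull is `w`
        have hwH : w ∈ extHullR ends R ζ := by
          obtain ⟨p, hp, q, hpq⟩ := he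
          rw [hxw, Sym2.eq_iff] at hpq
          rcases hpq with ⟨hxp, -⟩ | ⟨-, hwp⟩
          · exact absurd (hxp ▸ hp) hx'H
          · exact hwp ▸ hp
        rcases hP _ hu e x' w hxw ⟨hx', hx'H⟩ with hw | hw | hwl
        · exact ⟨w, unit_blue_closed hl hF hout hX hζ hne hy w hw.1 hw.2, x', ends_swap hxw⟩
        · exact absurd hwH hw.2
        · exfalso
          obtain ⟨r, hr, hlr⟩ := hwl ▸ hwH
          exact hl (hne r hr hlr)
    · rintro ⟨x', hx', w, hxw⟩
      exact ⟨x', ⟨x', hx', mem_unitOf_self x'⟩, w, hxw⟩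
  by_cases ht : e ∈ touches ends (blueUnits ends R l ζ)
  · rw [flip_apply_of_mem ht, flip_apply_of_mem (key.1 ht)]
  · rw [flip_apply_of_notMem ht, flip_apply_of_notMem (fun h' => ht (key.2 h'))]

/-- Disjointness: distinct units are disjoint. -/
def UnitsDisjoint (ends : E → Sym2 V) (R : Set V) (l : V) (ζ : Config E) : Prop :=
  ∀ u ∈ unitsR ends R l ζ, ∀ u' ∈ unitsR ends R l ζ, u ≠ u' → ∀ x, x ∈ u → x ∉ u'

/-- Attachment: every decoration vertex of a unit is blue-connected to `l` by blue edges of the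
decorated base touching its unit. -/
def Attached (ends : E → Sym2 V) (R : Set V) (l : V) (ζ : Config E) : Prop :=
  ∀ u ∈ unitsR ends R l ζ, ∀ z ∈ unitDeco ends R ζ u,
    z ∈ cluster ends (decoRoute ends u (baseDeco ends R l ζ)) l

/-- A root lies in no unit of the family. -/
lemma root_notMem_unit {u : Set V} (hu : u ∈ unitsR ends R l ζ) {r : V} (hr : r ∈ R) : r ∉ u := by
  intro hru
  obtain ⟨y, hyH, hyR, rfl⟩ := exists_of_mem_unitsR' hu
  have hrH : r ∈ extHullR ends R ζ := mem_extHullR_of_mem hr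
  rcases mem_redPartR_or_bluePartR hyH hyR with hy | hy
  · exact (unit_red_closed hl hF hout hX hζ hne hy r hru hrH).2 hr
  · exact (unit_blue_closed hl hF hout hX hζ hne hy r hru hrH).2 hr

/-- The arm part of a unit avoids the roots. -/
lemma unitArm_subset {u : Set V} (hu : u ∈ unitsR ends R l ζ) {x : V}
    (hx : x ∈ unitArm ends R ζ u) : x ∈ extHullR ends R ζ ∧ x ∉ R :=
  ⟨hx.2, fun hxR => root_notMem_unit hl hF hout hX hζ hne hu hxR hx.1⟩

/-- The unit of a hull vertex of a unit of the family is that unit. -/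
lemma unitOf_eq_of_mem_unitsR {u : Set V} (hu : u ∈ unitsR ends R l ζ) {x : V} (hx : x ∈ u)
    (hxH : x ∈ extHullR ends R ζ) : unitOf ends R l ζ x = u := by
  obtain ⟨y, hyH, hyR, rfl⟩ := exists_of_mem_unitsR' hu
  exact unitOf_eq_of_mem hl hF hout hX hζ hne hyH hyR hx hxH

/-- The arm of a hull vertex of a unit lies in the unit. -/
lemma armR_subset_of_mem_unitsR {u : Set V} (hu : u ∈ unitsR ends R l ζ) {x : V} (hx : x ∈ u)
    (hxH : x ∈ extHullR ends R ζ) : armR ends R ζ x ⊆ u := by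
  rw [← unitOf_eq_of_mem_unitsR hl hF hout hX hζ hne hu hx hxH]
  exact armR_subset_unitOf x

include hloop in
/-- **THE CANONICAL DECORATED BASE**: at a side point of a fibre of the escaping set whose units
are pure, pairwise disjoint and attached, the decorated base with the units is a decorated
multi-root base on the extended hull of the roots. -/
theorem decoBaseE_baseDeco (hP : Pure ends R l ζ) (hD : UnitsDisjoint ends R l ζ)
    (hA : Attached ends R l ζ) :
    DecoBaseE ends (baseDeco ends R l ζ) R (extHullR ends R ζ) l
      (fun u : ↥(unitsR ends R l ζ) => unitArm ends R ζ u.1)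
      (fun u : ↥(unitsR ends R l ζ) => unitDeco ends R ζ u.1) (rrEdges ends R) where
  base := by
    have hb₀ := Esc.multiBaseE_baseRR hl hloop hF hout hX hζ hne
    have hT : ∀ e ∈ touches ends (extHullR ends R ζ), baseDeco ends R l ζ e = baseRR ends R ζ e :=
      fun e he => baseDeco_eq_baseRR_of_touches hl hF hout hX hζ hne hP he
    exact
      { root_sub := hb₀.root_sub
        bdry_blue := by
          intro e x y hxy hxH hyH
          rw [hT e ⟨x, hxH, y, hxy⟩]
          exact hb₀.bdry_blue e x y hxy hxH hyH
        arm_sub := fun u x hx => unitArm_subset hl hF hout hX hζ hne u.2 hx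
        arm_nonempty := by
          intro u
          obtain ⟨y, hyH, -, hy⟩ := exists_of_mem_unitsR' u.2
          exact ⟨y, ⟨by rw [hy]; exact mem_unitOf_self y, hyH⟩⟩
        arm_disj := fun u u' huu' x hx hx' =>
          hD u.1 u.2 u'.1 u'.2 (fun h' => huu' (Subtype.ext h')) x hx.1 hx'.1
        arm_cover := fun x hxH hxR =>
          ⟨⟨unitOf ends R l ζ x, unitOf_mem_unitsR_of_mem hl hF hout hX hζ hne hxH hxR⟩,
            mem_unitOf_self x, hxH⟩
        no_cross := by
          intro u u' huu' e x y hxy hx hy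
          have hxR : x ∉ R := (unitArm_subset hl hF hout hX hζ hne u.2 hx).2
          have hyR : y ∉ R := (unitArm_subset hl hF hout hX hζ hne u'.2 hy).2
          have hyx : y ∈ armR ends R ζ x := by
            have he : armConfigR ends R ζ e = true := by
              simp only [armConfigR, decide_eq_true_eq]
              exact ⟨x, ⟨hx.2, hxR⟩, y, ⟨hy.2, hyR⟩, hxy⟩
            exact mem_cluster_of_edge (mem_armR_self x) he hxy
          have hyu : y ∈ u.1 := armR_subset_of_mem_unitsR hl hF hout hX hζ hne u.2 hx.1 hx.2 hyx
          exact hD u.1 u.2 u'.1 u'.2 (fun h' => huu' (Subtype.ext h')) y hyu hy.1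
        root_edges := by
          intro e r x hr hrx
          by_cases hxR : x ∈ R
          · exact Or.inl hxR
          · have hxH : x ∈ extHullR ends R ζ := ⟨r, hr, mem_hull_of_adj_root hrx⟩
            exact Or.inr ⟨⟨unitOf ends R l ζ x, unitOf_mem_unitsR_of_mem hl hF hout hX hζ hne hxH hxR⟩,
              mem_unitOf_self x, hxH⟩
        loop_root := hloop
        root_red := by
          intro e r x hr hrx
          rw [hT e ⟨r, mem_extHullR_of_mem hr, x, hrx⟩]
          exact hb₀.root_red e r x hr hrx
        rr_iff := fun e => mem_rrEdges
        conn := by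
          intro u x hx
          have hxR : x ∉ R := (unitArm_subset hl hF hout hX hζ hne u.2 hx).2
          have harm : armR ends R ζ x ∈ armsR ends R ζ := armR_mem_armsR_of_mem_extHullR hx.2 hxR
          obtain ⟨r, hr, hc⟩ := hb₀.conn ⟨armR ends R ζ x, harm⟩ x (mem_armR_self x)
          refine ⟨r, hr, cluster_mono ?_ r hc⟩
          intro e
          by_cases he : insideConfig ends (armsFun (armsR ends R ζ) ⟨armR ends R ζ x, harm⟩ ∪ {r})
              (baseRR ends R ζ) e = true
          · rw [he]
            obtain ⟨hbe, hw⟩ := insideConfig_eq_true_iff.1 he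
            have hw' : e ∈ within ends (unitArm ends R ζ u.1 ∪ {r}) := by
              obtain ⟨a, ha, b, hb, hab⟩ := hw
              have key : ∀ z, z ∈ armsFun (armsR ends R ζ) ⟨armR ends R ζ x, harm⟩ ∪ {r} →
                  z ∈ unitArm ends R ζ u.1 ∪ {r} := by
                rintro z (hz | hz)
                · exact Or.inl ⟨armR_subset_of_mem_unitsR hl hF hout hX hζ hne u.2 hx.1 hx.2 hz,
                    (armR_subset hx.2 hxR hz).1⟩
                · exact Or.inr hz
              exact ⟨a, key a ha, b, key b hb, hab⟩
            have hT' : baseDeco ends R l ζ e = true := by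
              rw [hT e (within_subset_touches ends _ (within_mono (by
                rintro z (hz | hz)
                · exact (armR_subset hx.2 hxR hz).1
                · rw [Set.mem_singleton_iff] at hz; rw [hz]; exact mem_extHullR_of_mem hr) hw))]
              exact hbe
            rw [insideConfig_eq_true_iff.2 ⟨hT', hw'⟩]
          · simp only [Bool.not_eq_true] at he
            rw [he]; exact Bool.false_le _ }
  l_notMem := fun h' => hl (Esc.extHullR_subset_U hne h')
  deco_notMem := fun _ z hz => hz.2
  deco_ne_l := by
    intro u hlu
    obtain ⟨y, hyH, -, hy⟩ := exists_of_mem_unitsR' u.2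
    have hyl : y ≠ l := fun h' => hl (Esc.extHullR_subset_U hne (h' ▸ hyH))
    exact l_notMem_unitOf (fun h' => hl (Esc.extHullR_subset_U hne h')) hyl (by rw [← hy]; exact hlu.1)
  deco_disj := fun u u' huu' z hz hz' =>
    hD u.1 u.2 u'.1 u'.2 (fun h' => huu' (Subtype.ext h')) z hz.1 hz'.1
  deco_edges := fun u e z y hzy hz => hP u.1 u.2 e z y hzy hz
  deco_conn := fun u z hz => by
    show z ∈ cluster ends (decoRoute ends (unitArm ends R ζ u.1 ∪ unitDeco ends R ζ u.1) _) l
    rw [unitArm_union_unitDeco]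
    exact hA u.1 u.2 z hz

/-- **The side point is the cube point `omegaDeco` of its decorated base.** -/
theorem decoRealRR_baseDeco_omegaDeco :
    decoRealRR ends (fun u : ↥(unitsR ends R l ζ) => unitArm ends R ζ u.1)
      (fun u : ↥(unitsR ends R l ζ) => unitDeco ends R ζ u.1) (rrEdges ends R)
      (baseDeco ends R l ζ) (omegaDeco ends R l ζ) = ζ := by
  funext e
  by_cases he : e ∈ rrEdges ends R
  · rw [decoRealRR_apply_rr he, baseDeco_apply_of_mem he]
    simp only [omegaDeco, Sum.elim_inr]
    by_cases hz : ζ e = true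
    · rw [if_pos hz, hz]
    · rw [if_neg hz, Bool.not_true]
      exact (Bool.eq_false_iff.mpr hz).symm
  · rw [decoRealRR_apply_of_notMem_rr he, ← blueUnits_eq hl hF hout hX hζ hne]
    have h2 : ∀ P : Set V, Hull.flip ends P (baseDeco ends R l ζ) e =
        Hull.flip ends P (Hull.flip ends (blueUnits ends R l ζ) ζ) e := by
      intro P
      by_cases ht : e ∈ touches ends P
      · rw [flip_apply_of_mem ht, flip_apply_of_mem ht, baseDeco_apply_of_notMem he]
      · rw [flip_apply_of_notMem ht, flip_apply_of_notMem ht, baseDeco_apply_of_notMem he]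
    rw [h2, Hull.flip_flip]

end Units

end LocRows

end Summit.Ventures.PercRepro2
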